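import Summits.QuantumFields.QCD.Theorems.PauliWegnerSeaChiralGluonicCompletionGoldstoneOfHereditaryPin

/-!
# Crux `ChiralGluonicCompletion` (stmt-QuantumFields-17498), line `Sketch` — the continuum stub in GLOBAL form and the
# rev-5 composition over it (lead cycle 3, 2026-08-17)

Stub C2 of the line was registered (rev 3/4) in the LOCAL form a compactness construction outputs: around every positive
tuple a mass box on which, from every subsequence, a further extraction carries `ContinuumBody` for all tuples of the box.
The composition only ever needs the GLOBAL form

  `(C2')  ∀ reg, Hyp N_f reg → (∀ m > 0, ∃ Δ > 0, (reg.scheme m 0 0).HasLatticeMassGap Δ) →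
            ∃ φ, ∀ m > 0, ContinuumBody N_f (reg.restrict φ) m`

(one subsequence for all positive tuples, and CONDITIONED on the uniform lattice gap at every positive tuple — C1's
output for the same regularisation — which aligns it with the ∀-regularisation frame of DiagonalSpine's continuum items
`RotationRestoration` 8840 / `CalibratedTightness` 14675 / `MassEquicontinuity` 14676, all conditioned on that gap;
suggestion of the cycle-3 C2 worker), which is WEAKER: `globalContinuum_of_local` below derives the unconditioned global
form from the local one by Lindelöf + the diagonal (`exists_countable_centres`, `continuumBody_transfer`,
`exists_diagonal`), exactly as the landed `CertifiedSeaThresholdGraft.stub_diagonal` does for the full matrix `Body`.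
Skeleton rev 5 registers C2 in this form; `chiralGluonicCompletion_of_hereditaryPin_globalContinuum` is its composition:
E* (hereditary pin along a subsequence) → C1 (lattice gap) → C2' → crux, with no diagonal left in the glue
(E is regained from E* ∧ C1 by `exists_restrict_hasGoldstoneBound_of_hereditaryPin`, the package passes to the Goldstone
subsequence by `hyp_restrict`, C2' — fed with C1's gap there — gives one further subsequence for all masses, C1 and
`body_of_parts` finish).
-/

noncomputable section

namespace Summit.QuantumFields.QCD.Theorems.StronglyChiralSubsequence

open MeasureTheory Filter Topology
open Literature.MathematicalPhysics.QuantumFieldTheory Literature.MathematicalPhysics.QuantumLattice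
  Literature.Probability.LatticeModels

variable {Nf : ℕ}

/-- **Transfer of the continuum matrix along eventual reindexings** (the `ContinuumBody` twin of
`CertifiedSeaThresholdGraft.body_transfer`, which is private to its file).  If `Θ₂ j = Θ₁ (θ j)` for all large `j` with
`θ → ∞`, then `ContinuumBody` at `m` along `reg.restrict Θ₁` (renormalisations `z, shift`, OS data `T`, gap `Δ`) gives it
along `reg.restrict Θ₂` with `z ∘ θ, shift ∘ θ` and the same `T, Δ`: asymptotic scaling reads `β_k, a_k`, the branch clause
reads `m_f(k)`, and the `k`-th lattice Schwinger function of `(reg.restrict Θ).scheme m z shift` is definitionally the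
`Θ k`-th one of `reg.scheme m` with the renormalisations frozen at their `k`-th values. [folklore] -/
theorem continuumBody_transfer (reg : QCDRegularisation Nf) (m : Fin Nf → ℝ) {Θ₁ Θ₂ θ : ℕ → ℕ}
    (hΘ₁ : StrictMono Θ₁) (hΘ₂ : StrictMono Θ₂) (hθ : Tendsto θ atTop atTop)
    (heq : ∀ᶠ j in atTop, Θ₂ j = Θ₁ (θ j)) (h : ContinuumBody Nf (reg.restrict Θ₁ hΘ₁.tendsto_atTop) m) :
    ContinuumBody Nf (reg.restrict Θ₂ hΘ₂.tendsto_atTop) m := by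
  obtain ⟨z, shift, T, ⟨hAS, hmq, hconv⟩, hNT, hNG, hPS, Δ, hΔ, hgap⟩ := h
  refine ⟨fun s j => z s (θ j), fun s j => shift s (θ j), T, ⟨?_, ?_, ?_⟩, hNT, hNG, hPS, Δ, hΔ, hgap⟩
  · -- asymptotic scaling reads `β_k, a_k`
    obtain ⟨Λ, hΛ, ht⟩ := hAS
    refine ⟨Λ, hΛ, (ht.comp hθ).congr' ?_⟩
    filter_upwards [heq] with j hj
    show reg.β (Θ₁ (θ j)) - afBeta Nf Λ (reg.a (Θ₁ (θ j))) = reg.β (Θ₂ j) - afBeta Nf Λ (reg.a (Θ₂ j))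
    rw [hj]
  · -- the physical-branch condition reads `m_f(k)`
    intro fl
    filter_upwards [hθ.eventually (hmq fl), heq] with j hj hj'
    show -1 < reg.mcrit (Θ₂ j) + reg.a (Θ₂ j) * m fl / reg.Zm (Θ₂ j)
    rw [hj']
    exact hj
  · -- the lattice Schwinger functions read the `k`-th data, definitionally
    intro n hn σ f F hF hoff
    refine ((hconv n hn σ f F hF hoff).comp hθ).congr' ?_
    filter_upwards [heq] with j hj
    show qcdLatticeSchwinger (reg.scheme m (fun s _ => z s (θ j)) (fun s _ => shift s (θ j))) (Θ₁ (θ j)) n σ f =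
      qcdLatticeSchwinger (reg.scheme m (fun s _ => z s (θ j)) (fun s _ => shift s (θ j))) (Θ₂ j) n σ f
    rw [hj]

/-- **Countably many centres suffice** (Lindelöf; the positive-orthant case of the private
`CertifiedSeaThresholdGraft.exists_countable_centres`).  Given radii `ε m₀ > 0` for the positive tuples `m₀`, a sequence of
positive centres `c i` has every positive tuple in one of the boxes `{m | ∀ f, |m f - c i f| < ε (c i)}`. [folklore] -/
theorem exists_countable_centres (ε : (Fin Nf → ℝ) → ℝ) (hε : ∀ m₀ : Fin Nf → ℝ, (∀ f, 0 < m₀ f) → 0 < ε m₀) :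
    ∃ c : ℕ → Fin Nf → ℝ, (∀ i f, 0 < c i f) ∧
      ∀ m : Fin Nf → ℝ, (∀ f, 0 < m f) → ∃ i, ∀ f, |m f - c i f| < ε (c i) := by
  obtain ⟨t, htU, htc, hUt⟩ := TopologicalSpace.countable_cover_nhdsWithin
    (s := {m : Fin Nf → ℝ | ∀ f, 0 < m f}) (f := fun x => Metric.ball x (ε x))
    fun x hx => mem_nhdsWithin_of_mem_nhds (Metric.ball_mem_nhds x (hε x hx))
  obtain ⟨c, hc⟩ := (htc.insert (fun _ => 1 : Fin Nf → ℝ)).exists_eq_range (Set.insert_nonempty _ _)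
  refine ⟨c, fun i => ?_, fun m hm => ?_⟩
  · have hci : c i ∈ insert (fun _ => 1 : Fin Nf → ℝ) t := by rw [hc]; exact Set.mem_range_self i
    rcases Set.mem_insert_iff.1 hci with h | h
    · rw [h]; exact fun _ => one_pos
    · exact htU h
  · have hmU : m ∈ {m : Fin Nf → ℝ | ∀ f, 0 < m f} := hm
    obtain ⟨x, hx, hmx⟩ := Set.mem_iUnion₂.1 (hUt hmU)
    have hxc : x ∈ Set.range c := by rw [← hc]; exact Set.mem_insert_of_mem _ hx
    obtain ⟨i, rfl⟩ := hxc
    refine ⟨i, fun f => ?_⟩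
    have h := (dist_pi_lt_iff (hε _ (htU hx))).1 (Metric.mem_ball.1 hmx) f
    rwa [Real.dist_eq] at h

/-- **Local ⟹ global continuum half** (one subsequence for all positive tuples).  If around every positive tuple there is
a mass box on which, from EVERY subsequence of `reg`, a further extraction carries `ContinuumBody` for all positive
tuples of the box, then ONE subsequence of `reg` carries `ContinuumBody` at every positive tuple: countably many boxes
cover the orthant, and the diagonal runs over "`ContinuumBody` on the `i`-th box along `reg.restrict Θ`", reachable by
extraction and stable under eventual reindexing (`continuumBody_transfer`).  So the GLOBAL form of stub C2 (rev 5) is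
weaker than the LOCAL form registered at rev 3/4. [folklore] -/
theorem globalContinuum_of_local (reg : QCDRegularisation Nf)
    (hloc : ∀ m₀ : Fin Nf → ℝ, (∀ f, 0 < m₀ f) → ∃ ε : ℝ, 0 < ε ∧
      ∀ (ψ : ℕ → ℕ) (hψ : StrictMono ψ), ∃ (φ : ℕ → ℕ) (hφ : StrictMono φ),
        ∀ m : Fin Nf → ℝ, (∀ f, 0 < m f) → (∀ f, |m f - m₀ f| < ε) →
          ContinuumBody Nf (reg.restrict (ψ ∘ φ) (hψ.comp hφ).tendsto_atTop) m) :
    ∃ φ : ℕ → ℕ, ∃ hφ : StrictMono φ, ∀ m : Fin Nf → ℝ, (∀ f, 0 < m f) →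
      ContinuumBody Nf (reg.restrict φ hφ.tendsto_atTop) m := by
  choose! ε hε hH using hloc
  obtain ⟨c, hc, hcov⟩ := exists_countable_centres ε hε
  obtain ⟨Φ, hΦ, hP⟩ := exists_diagonal
    (P := fun i Θ => ∀ hΘ : StrictMono Θ, ∀ m : Fin Nf → ℝ, (∀ f, 0 < m f) →
      (∀ f, |m f - c i f| < ε (c i)) → ContinuumBody Nf (reg.restrict Θ hΘ.tendsto_atTop) m)
    (fun i ψ hψ => by
      obtain ⟨φ, hφ, h⟩ := hH (c i) (hc i) ψ hψ
      exact ⟨φ, hφ, fun _ m hm hmi => h m hm hmi⟩)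
    (fun i Θ₁ Θ₂ θ hΘ₁ _ hθ heq h hΘ₂ m hm hmi =>
      continuumBody_transfer reg m hΘ₁ hΘ₂ hθ heq (h hΘ₁ m hm hmi))
  exact ⟨Φ, hΦ, fun m hm => (hcov m hm).elim fun i hi => hP i hΦ m hm hi⟩

/-! ## The rev-5 composition of line `Sketch`: E* → C1 → C2' → crux -/

/-- **The composition of line `Sketch`, skeleton rev 5.**  A conditional theorem whose three hypotheses are verbatim the
registered stubs of rev 5: (E*) along some subsequence the pin holds hereditarily, (C1) the signed lattice gap at every
positive tuple at the given critical line, (C2') ONE subsequence carrying the continuum half at every positive tuple.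
Proof: E* ∧ C1 give a Goldstone subsequence `reg.restrict θ` (`exists_restrict_hasGoldstoneBound_of_hereditaryPin`), which
inherits the package (`hyp_restrict`); C2' along it gives `φ₁`; the Goldstone bound, hence the package and the pin, pass to
`(reg.restrict θ).restrict φ₁`, where C1 supplies the lattice gap and `body_of_parts` the matrix of `QCDOf`. -/
theorem chiralGluonicCompletion_of_hereditaryPin_globalContinuum : (∀ Nf : ℕ, Nf = 2 ∨ Nf = 3 → ∀ reg : QCDRegularisation Nf, Hyp Nf reg → ∃ φ : ℕ → ℕ, ∃ hφ : StrictMono φ, ∀ (ψ : ℕ → ℕ) (hψ : StrictMono ψ), ((reg.restrict φ hφ.tendsto_atTop).restrict ψ hψ.tendsto_atTop).IsChiralAtZero) → (∀ Nf : ℕ, Nf = 2 ∨ Nf = 3 → ∀ reg : QCDRegularisation Nf, Hyp Nf reg → ∀ m : Fin Nf → ℝ, (∀ f, 0 < m f) → ∃ Δ > 0, (reg.scheme m 0 0).HasLatticeMassGap Δ) → (∀ Nf : ℕ, Nf = 2 ∨ Nf = 3 → ∀ reg : QCDRegularisation Nf, Hyp Nf reg → (∀ m : Fin Nf → ℝ,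 (∀ f, 0 < m f) → ∃ Δ > 0, (reg.scheme m 0 0).HasLatticeMassGap Δ) → ∃ φ : ℕ → ℕ, ∃ hφ : StrictMono φ, ∀ m : Fin Nf → ℝ, (∀ f, 0 < m f) → ContinuumBody Nf (reg.restrict φ hφ.tendsto_atTop) m) → Summit.QuantumFields.QCD.Theses.PauliWegnerSea.ChiralGluonicCompletion := by
  intro hE hC1 hC2 Nf hNf hex
  obtain ⟨reg, hH⟩ := hex
  -- E* ∧ C1: a Goldstone subsequence, carrying the package
  obtain ⟨φ, hφ, hher⟩ := hE Nf hNf reg hH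
  obtain ⟨θ, hθ, hG⟩ := exists_restrict_hasGoldstoneBound_of_hereditaryPin reg φ hφ hher (hC1 Nf hNf reg hH)
  have hH₀ : Hyp Nf (reg.restrict θ hθ.tendsto_atTop) := hyp_restrict reg θ hθ hH hG
  -- C2' (fed with C1's gap along `θ`): one further subsequence for all masses; Goldstone bound and package ride along
  obtain ⟨φ₁, hφ₁, hcont⟩ := hC2 Nf hNf _ hH₀ (hC1 Nf hNf _ hH₀)
  have hG₁ : ((reg.restrict θ hθ.tendsto_atTop).restrict φ₁ hφ₁.tendsto_atTop).HasGoldstoneBound :=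
    hG.restrict φ₁ hφ₁.tendsto_atTop
  have hH₁ : Hyp Nf ((reg.restrict θ hθ.tendsto_atTop).restrict φ₁ hφ₁.tendsto_atTop) :=
    hyp_restrict _ φ₁ hφ₁ hH₀ hG₁
  unfold QCDOf
  exact ⟨(reg.restrict θ hθ.tendsto_atTop).restrict φ₁ hφ₁.tendsto_atTop, hH₁.1, hG₁.isChiralAtZero,
    fun m hm => body_of_parts _ m (hcont m hm) (hC1 Nf hNf _ hH₁ m hm)⟩

/-- The LOCAL form of C2 (rev 3/4 registration) implies the GLOBAL, gap-conditioned form (rev 5), witness by witness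
(the lattice-gap hypothesis of the rev-5 stub is simply not used). -/
theorem continuumGlobal_of_continuumLocal
    (hC2 : ∀ Nf : ℕ, Nf = 2 ∨ Nf = 3 → ∀ reg : QCDRegularisation Nf, Hyp Nf reg → ∀ m₀ : Fin Nf → ℝ, (∀ f, 0 < m₀ f) → ∃ ε : ℝ, 0 < ε ∧ ∀ (ψ : ℕ → ℕ) (hψ : StrictMono ψ), ∃ (φ : ℕ → ℕ) (hφ : StrictMono φ), ∀ m : Fin Nf → ℝ, (∀ f, 0 < m f) → (∀ f, |m f - m₀ f| < ε) → ContinuumBody Nf (reg.restrict (ψ ∘ φ) (hψ.comp hφ).tendsto_atTop) m) :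
    ∀ Nf : ℕ, Nf = 2 ∨ Nf = 3 → ∀ reg : QCDRegularisation Nf, Hyp Nf reg →
      (∀ m : Fin Nf → ℝ, (∀ f, 0 < m f) → ∃ Δ > 0, (reg.scheme m 0 0).HasLatticeMassGap Δ) →
        ∃ φ : ℕ → ℕ, ∃ hφ : StrictMono φ,
          ∀ m : Fin Nf → ℝ, (∀ f, 0 < m f) → ContinuumBody Nf (reg.restrict φ hφ.tendsto_atTop) m :=
  fun Nf hNf reg hH _ => globalContinuum_of_local reg (hC2 Nf hNf reg hH)

end Summit.QuantumFields.QCD.Theorems.StronglyChiralSubsequence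

end
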